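import Mathlib
import Summits.NavierStokesRegularity.NavierStokesRegularity.Theses.SubcriticalEnvelope
import HarnessLib

/-!
# `SubcriticalEnvelope.Assembly` — the route's assembly (item stmt-NavierStokesRegularity-23907; pure logic)

**Statement.** `SubcriticalTailEnvelope → EnvelopeSmoothing → TaoLadderRungTwoBreak.Target`.

PROOF. The route file's deciding theorem `Theses.SubcriticalEnvelope.closes` takes the two cruxes and
the glue `StallOfEnvelope`; the glue is pure logic (tree theorem
`subcriticalEnvelope_stallOfEnvelope_proof`, re-derived inline here in three lines so that this file
imports only the route file), so the assembly is `closes h₁ h₂ (glue)`. An IMPLICATION only: both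
cruxes remain hypotheses.

HONEST FRAMING: pure logic about a Tao-type MODEL lattice rung; nothing about Navier–Stokes.
-/

noncomputable section

set_option linter.dupNamespace false

namespace Summit.NavierStokesRegularity.NavierStokesRegularity.Theorems

open Summit.NavierStokesRegularity.NavierStokesRegularity.Theses.SubcriticalEnvelope in
/-- **Item stmt-NavierStokesRegularity-23907** (`SubcriticalEnvelope.Assembly`): the two cruxes imply the
rung `TaoLadderRungTwoBreak.Target`, by the route file's deciding theorem `closes` with the glue
`StallOfEnvelope` re-derived inline (pure logic). [this file] -/
theorem subcriticalEnvelope_assembly_proof :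
    Summit.NavierStokesRegularity.NavierStokesRegularity.Theses.SubcriticalEnvelope.Assembly := by
  unfold Summit.NavierStokesRegularity.NavierStokesRegularity.Theses.SubcriticalEnvelope.Assembly
  -- (buildfix 2026-08-28) the route's `closes` was re-keyed (06:50Z) to `ViscousTailEnvelope` /
  -- `ViscousEnvelopeSmoothing`; this CLOSED assembly keeps its accepted statement over
  -- `SubcriticalTailEnvelope` / `EnvelopeSmoothing`, so the pre-edit chain is inlined: the viscous stall
  -- (`StallOfEnvelope`, re-derived exactly as before) fed to `noRobustBlowupBelow_of_viscousStall`.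
  unfold Summit.NavierStokesRegularity.NavierStokesRegularity.Theses.SubcriticalEnvelope.SubcriticalTailEnvelope
    Summit.NavierStokesRegularity.NavierStokesRegularity.Theses.SubcriticalEnvelope.EnvelopeSmoothing
  intro hA hB R hR
  apply Literature.Analysis.FluidPDE.TaoCascade.noRobustBlowupBelow_of_viscousStall
  obtain ⟨η, εs, hη, hεs, hAR⟩ := hA R hR
  refine ⟨εs, hεs, fun ε₀ hε₀ hle α X₀ hα ν hν => ?_⟩
  exact hB ε₀ η R hε₀ hη α hα X₀ (fun K₁ hK₁ => hAR ε₀ hε₀ hle α hα X₀ K₁ hK₁) ν hν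

end Summit.NavierStokesRegularity.NavierStokesRegularity.Theorems

end
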